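import Literature.NumberTheory.Transcendental.AyoubPeriodSeriesKernel
import Mathlib.MeasureTheory.Integral.Pi
import Mathlib.MeasureTheory.Integral.DominatedConvergence
import Mathlib.Analysis.SpecialFunctions.Integrals.Basic
import Mathlib.Data.Finsupp.Encodable

/-!
# `StokesGeneration` (stmt-KontsevichZagierPeriods-3586), line `Sketch`, stub `stub_germToOan` — part 3:
the complex series of a real germ on the cube, and cube integrals

Support file for the registered stub `stub_germToOan` (dictionary, analytic half) of the crux
`StokesGeneration` (route UnfoldedStokes, line `Sketch` = card cube-type-a-generation), on top of
`Literature/NumberTheory/Transcendental/AyoubPeriodSeries.lean` (`AyoubRel.CSeries = ℂ[[z₀, z₁, …]]`,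
`AyoubRel.DependsOnlyOnLT`, `AyoubRel.intC`).

* Exponents `a : Fin N →₀ ℕ` are pushed into `ℕ →₀ ℕ` along `Finsupp.embDomain Fin.valEmbedding`
  (injective, degree-preserving; the complement of the range is the set of exponents involving a
  variable `zᵢ`, `i ≥ N`).
* THE SERIES OF A GERM (`exists_series_of_coeff`): for real coefficients `c : (Fin N →₀ ℕ) → ℝ` there
  is `F ∈ ℂ[[z₀, z₁, …]]` with `coeff (push a) F = cₐ` and all other coefficients `0`; every later
  property is derived from these two coefficient clauses alone: `F` depends only on
  `z₀, …, z_{N-1}` (`dependsOnlyOnLT_of_coeff`), its weighted coefficient family is that of `c`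
  (`summable_weighted_of_coeff`, polyradius), its value at the point of the polydisc attached to
  `x ∈ [0,1]ᴺ` is `Σₐ cₐ xᵃ` (`hasSum_eval_of_coeff`), and `∫_{[0,1]^∞} F = Σₐ cₐ ∏ⱼ (aⱼ+1)⁻¹`
  (`intC_eq_of_coeff`).
* CUBE INTEGRALS: `∫_{[0,1]ᴺ} xᵃ dx = ∏ⱼ (aⱼ+1)⁻¹` (`integral_cube_monomial`, Fubini) and termwise
  integration of an absolutely convergent power series over the cube (`integral_cube_eq_tsum`).

This is the bookkeeping of the dictionary between real germs on the cube and Ayoub's series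
`𝒪_{ℚ̄-alg}(𝔻̄^∞)` (J. Ayoub, EMS Newsl. 91 (2014) §2.2, Def. 9–10, Rem. 13). No definition is
introduced.
-/

noncomputable section

-- `Summit.KontsevichZagierPeriods.KontsevichZagierPeriods.…` is the tree's mandated layout (single-conjunct summit).
set_option linter.dupNamespace false

namespace Summit.KontsevichZagierPeriods.KontsevichZagierPeriods.StokesGenerationLine

open MeasureTheory Set
open Literature.NumberTheory.Transcendental

/-! ## Exponents: `Fin N →₀ ℕ` inside `ℕ →₀ ℕ` along `Fin.valEmbedding` -/

section Reindex

variable {N : ℕ}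

/-- An exponent with a non-zero entry at an index `≥ N` is not pushed forward from `Fin N`.
[folklore] -/
theorem not_mem_range_embDomain_of_exists {b : ℕ →₀ ℕ} (hb : ∃ i, N ≤ i ∧ b i ≠ 0) :
    b ∉ Set.range (Finsupp.embDomain (M := ℕ) (Fin.valEmbedding (n := N))) := by
  rintro ⟨a, rfl⟩
  obtain ⟨i, hi, hne⟩ := hb
  refine hne (Finsupp.embDomain_notin_range _ _ _ ?_)
  rintro ⟨j, rfl⟩
  exact absurd j.is_lt (not_lt.2 hi)

/-- An exponent not pushed forward from `Fin N` has a non-zero entry at an index `≥ N`.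
[folklore] -/
theorem exists_of_not_mem_range_embDomain {b : ℕ →₀ ℕ}
    (hb : b ∉ Set.range (Finsupp.embDomain (M := ℕ) (Fin.valEmbedding (n := N)))) :
    ∃ i, N ≤ i ∧ b i ≠ 0 := by
  by_contra hcon
  push Not at hcon
  refine hb ⟨Finsupp.equivFunOnFinite.symm (fun j : Fin N => b j), Finsupp.ext fun i => ?_⟩
  by_cases hi : i ∈ Set.range (Fin.valEmbedding (n := N))
  · obtain ⟨j, rfl⟩ := hi
    rw [Finsupp.embDomain_apply_self]
    simp
  · rw [Finsupp.embDomain_notin_range _ _ _ hi]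
    refine (hcon i (not_lt.1 fun hlt => hi ⟨⟨i, hlt⟩, rfl⟩)).symm

/-- Pushing an exponent forward along `Fin N ↪ ℕ` preserves its degree. [folklore] -/
theorem degree_embDomain_valEmbedding (a : Fin N →₀ ℕ) :
    (Finsupp.embDomain Fin.valEmbedding a).degree = a.degree := by
  rw [Finsupp.embDomain_eq_mapDomain, Finsupp.degree_mapDomain]

/-- The integration weight `∏ᵢ (bᵢ + 1)⁻¹` of a pushed-forward exponent. [folklore] -/
theorem prod_weight_embDomain (a : Fin N →₀ ℕ) :
    ∏ i ∈ (Finsupp.embDomain Fin.valEmbedding a).support,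
        ((((Finsupp.embDomain Fin.valEmbedding a) i : ℕ) : ℂ) + 1)⁻¹ =
      ∏ j, (((a j : ℕ) : ℂ) + 1)⁻¹ := by
  change (Finsupp.embDomain Fin.valEmbedding a).prod (fun _ e => ((e : ℂ) + 1)⁻¹) = _
  rw [Finsupp.prod_embDomain, Finsupp.prod_fintype _ _ (fun j => by simp)]

/-- The point of the closed unit polydisc attached to `x ∈ [0,1]ᴺ` (coordinates `x`, then `0`)
has all coordinates of modulus `≤ 1`. [folklore] -/
theorem norm_cubePt_le_one (x : Fin N → ℝ) (hx : ∀ j, x j ∈ Set.Icc (0:ℝ) 1) (i : ℕ) :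
    ‖(fun i : ℕ => if hi : i < N then ((x ⟨i, hi⟩ : ℝ) : ℂ) else 0) i‖ ≤ 1 := by
  simp only
  split_ifs with hi
  · rw [Complex.norm_real, Real.norm_of_nonneg (hx _).1]
    exact (hx _).2
  · simp

/-- The monomial of a pushed-forward exponent at the point attached to `x` is `∏ⱼ xⱼ^{aⱼ}`.
[folklore] -/
theorem prod_pow_embDomain_cubePt (x : Fin N → ℝ) (a : Fin N →₀ ℕ) :
    (Finsupp.embDomain Fin.valEmbedding a).prod
        (fun i e => (fun i : ℕ => if hi : i < N then ((x ⟨i, hi⟩ : ℝ) : ℂ) else 0) i ^ e) =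
      ∏ j, ((x j : ℝ) : ℂ) ^ (a j) := by
  rw [Finsupp.prod_embDomain, Finsupp.prod_fintype _ _ (fun j => pow_zero _)]
  refine Finset.prod_congr rfl fun j _ => ?_
  simp only [Fin.valEmbedding_apply, dif_pos j.is_lt, Fin.eta]

end Reindex

/-! ## The series `F` attached to the real germ: construction and first properties -/

section Series

variable {N : ℕ}

/-- **The complex series of the germ**: there is `F ∈ ℂ[[z₀, z₁, …]]` whose coefficient at an
exponent pushed forward from `a : Fin N →₀ ℕ` is `cₐ` and whose other coefficients vanish
(extension by zero along the injection `Finsupp.embDomain Fin.valEmbedding`).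
[cite: Ayoub2014, Def. 9 and Rem. 13] -/
theorem exists_series_of_coeff (N : ℕ) (c : (Fin N →₀ ℕ) → ℝ) :
    ∃ F : AyoubRel.CSeries,
      (∀ a : Fin N →₀ ℕ, MvPowerSeries.coeff (a.embDomain Fin.valEmbedding) F = (c a : ℂ)) ∧
      (∀ b : ℕ →₀ ℕ, b ∉ Set.range (Finsupp.embDomain (Fin.valEmbedding (n := N))) →
        MvPowerSeries.coeff b F = 0) := by
  have hinj := Finsupp.embDomain_injective (M := ℕ) (Fin.valEmbedding (n := N))
  refine ⟨fun b => Function.extend (Finsupp.embDomain (M := ℕ) (Fin.valEmbedding (n := N)))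
    (fun a => ((c a : ℝ) : ℂ)) 0 b, fun a => ?_, fun b hb => ?_⟩
  · rw [MvPowerSeries.coeff_apply]
    exact hinj.extend_apply _ _ a
  · rw [MvPowerSeries.coeff_apply]
    exact Function.extend_apply' _ _ _ fun ⟨a, ha⟩ => hb ⟨a, ha⟩

variable {c : (Fin N →₀ ℕ) → ℝ} {F : AyoubRel.CSeries}
  (hFc : ∀ a : Fin N →₀ ℕ, MvPowerSeries.coeff (a.embDomain Fin.valEmbedding) F = (c a : ℂ))
  (hFz : ∀ b : ℕ →₀ ℕ, b ∉ Set.range (Finsupp.embDomain (Fin.valEmbedding (n := N))) →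
    MvPowerSeries.coeff b F = 0)
include hFz

/-- `F` depends only on `z₀, …, z_{N-1}`. [cite: Ayoub2014, Def. 9] -/
theorem dependsOnlyOnLT_of_coeff : AyoubRel.DependsOnlyOnLT F N := fun _ hb =>
  hFz _ (not_mem_range_embDomain_of_exists hb)

include hFc

/-- The weighted coefficient family of `F` is that of `c`, re-indexed: polyradius `R`.
[cite: Ayoub2014, Def. 9] -/
theorem summable_weighted_of_coeff {R : ℝ}
    (hsum : Summable fun a : Fin N →₀ ℕ => |c a| * R ^ a.degree) :
    Summable fun b : ℕ →₀ ℕ => ‖MvPowerSeries.coeff b F‖ * R ^ b.degree := by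
  have hinj := Finsupp.embDomain_injective (M := ℕ) (Fin.valEmbedding (n := N))
  refine (hinj.summable_iff ?_).1 (hsum.congr fun a => ?_)
  · intro b hb
    rw [hFz b hb, norm_zero, zero_mul]
  · simp only [Function.comp_apply]
    rw [hFc a, Complex.norm_real, Real.norm_eq_abs, degree_embDomain_valEmbedding]

/-- **Evaluation of `F` on the cube**: if `Σₐ cₐ xᵃ = s`, then `F` evaluated at the point attached
to `x` is `s`. [cite: Ayoub2014, Rem. 13] -/
theorem hasSum_eval_of_coeff (x : Fin N → ℝ) {s : ℝ}
    (hs : HasSum (fun a : Fin N →₀ ℕ => c a * ∏ j, x j ^ a j) s) :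
    HasSum (fun b : ℕ →₀ ℕ => MvPowerSeries.coeff b F *
      b.prod (fun i e => (fun i : ℕ => if hi : i < N then ((x ⟨i, hi⟩ : ℝ) : ℂ) else 0) i ^ e))
      (s : ℂ) := by
  have hinj := Finsupp.embDomain_injective (M := ℕ) (Fin.valEmbedding (n := N))
  refine (hinj.hasSum_iff ?_).1 ?_
  · intro b hb
    rw [hFz b hb, zero_mul]
  · have hs' : HasSum (fun a : Fin N →₀ ℕ => ((c a * ∏ j, x j ^ a j : ℝ) : ℂ)) (s : ℂ) :=
      Complex.hasSum_ofReal.2 hs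
    convert hs' using 1
    funext a
    simp only [Function.comp_apply]
    rw [hFc a, prod_pow_embDomain_cubePt]
    push_cast
    rfl

/-- **`∫_{[0,1]^∞} F = Σₐ cₐ ∏ⱼ (aⱼ + 1)⁻¹`** (re-indexing the defining sum of `AyoubRel.intC`).
[cite: Ayoub2014, Def. 10] -/
theorem intC_eq_of_coeff :
    AyoubRel.intC F = ∑' a : Fin N →₀ ℕ, (c a : ℂ) * ∏ j, (((a j : ℕ) : ℂ) + 1)⁻¹ := by
  have hinj := Finsupp.embDomain_injective (M := ℕ) (Fin.valEmbedding (n := N))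
  rw [AyoubRel.intC, ← hinj.tsum_eq (f := fun b : ℕ →₀ ℕ =>
    MvPowerSeries.coeff b F * ∏ i ∈ b.support, (((b i : ℕ) : ℂ) + 1)⁻¹) ?_]
  · refine tsum_congr fun a => ?_
    rw [hFc a, prod_weight_embDomain]
  · intro b hb
    by_contra hb'
    exact hb (by simp only [hFz b hb', zero_mul])

end Series

/-! ## The integral over the cube -/

/-- The closed unit cube has volume `1`. [folklore] -/
theorem volume_unitCube (N : ℕ) :
    volume (Set.pi Set.univ (fun _ : Fin N => Set.Icc (0:ℝ) 1)) = 1 := by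
  rw [volume_pi, Measure.pi_pi]
  simp [Real.volume_Icc]

/-- `∫_{[0,1]ᴺ} xᵃ dx = ∏ⱼ (aⱼ + 1)⁻¹` (Fubini and `∫₀¹ tᵏ dt = (k+1)⁻¹`).
[cite: Ayoub2014, Def. 10] -/
theorem integral_cube_monomial {N : ℕ} (a : Fin N →₀ ℕ) :
    ∫ x in Set.pi Set.univ (fun _ : Fin N => Set.Icc (0:ℝ) 1), ∏ j, x j ^ a j =
      ∏ j, (((a j : ℕ) : ℝ) + 1)⁻¹ := by
  have hrestr : (volume : Measure (Fin N → ℝ)).restrict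
      (Set.pi Set.univ (fun _ : Fin N => Set.Icc (0:ℝ) 1)) =
      Measure.pi (fun _ : Fin N => (volume : Measure ℝ).restrict (Set.Icc 0 1)) := by
    rw [volume_pi, Measure.restrict_pi_pi]
  have hF := integral_fintype_prod_eq_prod (𝕜 := ℝ)
    (μ := fun _ : Fin N => (volume : Measure ℝ).restrict (Set.Icc 0 1))
    (fun (j : Fin N) (t : ℝ) => t ^ a j)
  rw [hrestr, hF]
  refine Finset.prod_congr rfl fun j _ => ?_
  rw [integral_Icc_eq_integral_Ioc, ← intervalIntegral.integral_of_le zero_le_one, integral_pow]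
  simp

/-- **Termwise integration**: `∫_{[0,1]ᴺ} h = Σₐ cₐ ∏ⱼ (aⱼ + 1)⁻¹` for `h = Σₐ cₐ xᵃ` on the cube
with `Σₐ |cₐ| R^{|a|} < ∞`, `R > 1` (dominated by `Σ |cₐ|` on a set of volume `1`).
[cite: Ayoub2014, Rem. 13] -/
theorem integral_cube_eq_tsum {N : ℕ} {h : (Fin N → ℝ) → ℝ} {c : (Fin N →₀ ℕ) → ℝ} {R : ℝ}
    (hR : 1 < R) (hsum : Summable fun a : Fin N →₀ ℕ => |c a| * R ^ a.degree)
    (hh : ∀ x ∈ Set.pi Set.univ (fun _ : Fin N => Set.Icc (0:ℝ) 1),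
      HasSum (fun a : Fin N →₀ ℕ => c a * ∏ j, x j ^ a j) (h x)) :
    ∫ x in Set.pi Set.univ (fun _ : Fin N => Set.Icc (0:ℝ) 1), h x =
      ∑' a : Fin N →₀ ℕ, c a * ∏ j, (((a j : ℕ) : ℝ) + 1)⁻¹ := by
  have habs : Summable fun a : Fin N →₀ ℕ => |c a| :=
    hsum.of_nonneg_of_le (fun _ => abs_nonneg _) fun a =>
      le_mul_of_one_le_right (abs_nonneg _) (one_le_pow₀ hR.le)
  have hmeas : MeasurableSet (Set.pi Set.univ (fun _ : Fin N => Set.Icc (0:ℝ) 1)) :=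
    MeasurableSet.univ_pi fun _ => measurableSet_Icc
  have hcpt : IsCompact (Set.pi Set.univ (fun _ : Fin N => Set.Icc (0:ℝ) 1)) :=
    isCompact_univ_pi fun _ => isCompact_Icc
  have hcont : ∀ a : Fin N →₀ ℕ, Continuous fun x : Fin N → ℝ => c a * ∏ j, x j ^ a j := fun a =>
    continuous_const.mul (continuous_finsetProd _ fun j _ => (continuous_apply j).pow _)
  rw [setIntegral_congr_fun hmeas (fun x hx => (hh x hx).tsum_eq.symm),
    ← integral_tsum_of_summable_integral_norm]
  · exact tsum_congr fun a => by rw [integral_const_mul, integral_cube_monomial]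
  · exact fun a => (hcont a).continuousOn.integrableOn_compact hcpt
  · refine habs.of_nonneg_of_le (fun a => integral_nonneg fun _ => norm_nonneg _) fun a => ?_
    have hle : ∀ x ∈ Set.pi Set.univ (fun _ : Fin N => Set.Icc (0:ℝ) 1),
        ‖(fun x : Fin N → ℝ => ‖c a * ∏ j, x j ^ a j‖) x‖ ≤ |c a| := by
      intro x hx
      rw [Set.mem_univ_pi] at hx
      rw [norm_norm, norm_mul, Real.norm_eq_abs, norm_prod]
      refine mul_le_of_le_one_right (abs_nonneg _) (Finset.prod_le_one (fun j _ => norm_nonneg _)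
        fun j _ => ?_)
      rw [norm_pow, Real.norm_of_nonneg (hx j).1]
      exact pow_le_one₀ (hx j).1 (hx j).2
    have hbd := norm_setIntegral_le_of_norm_le_const (by rw [volume_unitCube]; simp) hle
    rw [measureReal_def, volume_unitCube, ENNReal.toReal_one, mul_one] at hbd
    exact (Real.le_norm_self _).trans hbd

/-! ## Registered form -/

/-- **Registered auxiliary stub** `stub_germToOanAuxSeries` (sub-goal of `stub_germToOan`, crux
stmt-KontsevichZagierPeriods-3586): termwise integration over the closed unit cube of a real power
series of polyradius `> 1`, `∫_{[0,1]ᴺ} h = Σₐ cₐ ∏ⱼ (aⱼ+1)⁻¹`, in the form registered on the ledger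
(= `integral_cube_eq_tsum`, the set integral written without notation). [cite: Ayoub2014, Rem. 13] -/
theorem stub_germToOanAuxSeries :
    ∀ (N : ℕ) (h : (Fin N → ℝ) → ℝ) (c : (Fin N →₀ ℕ) → ℝ) (R : ℝ), 1 < R →
      Summable (fun a : Fin N →₀ ℕ => |c a| * R ^ a.degree) →
      (∀ x ∈ Set.pi Set.univ (fun _ : Fin N => Set.Icc (0:ℝ) 1),
        HasSum (fun a : Fin N →₀ ℕ => c a * ∏ j, x j ^ a j) (h x)) →
      MeasureTheory.integral (MeasureTheory.Measure.restrict MeasureTheory.volume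
        (Set.pi Set.univ (fun _ : Fin N => Set.Icc (0:ℝ) 1))) (fun x => h x) =
      ∑' a : Fin N →₀ ℕ, c a * ∏ j, (((a j : ℕ) : ℝ) + 1)⁻¹ :=
  fun _ _ _ _ hR hsum hh => integral_cube_eq_tsum hR hsum hh

end Summit.KontsevichZagierPeriods.KontsevichZagierPeriods.StokesGenerationLine
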